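/-
Copyright: statement-level skeleton of a published paper (lit-balaban cell, Phase-2 proof seat p39 gen 17). No proof claims
beyond what the kernel checks below.
-/
import Literature.MathematicalPhysics.QuantumFieldTheory.Balaban1983to89.B3Ineq313Lattice
import Literature.MathematicalPhysics.QuantumFieldTheory.Balaban1983to89.B3Eq330EtaZeroLattice

/-!
# Bałaban, *(Higgs)₂,₃ quantum fields in a finite volume. III*, CMP 88 (1983): (3.26) and (3.31) ON THE PRINT'S CARRIER
# `ηℤ^{d+1}` — the vector self-energy graphs, their Taylor rearrangement, the resummation over the line indices, the Π-forms of
# pp. 440–441 as `Λ′ ↑ ℤ³` limits, and the degree-0 split (3.31)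

[cite: Balaban1983Higgs3, (3.26) p.440 (PDF 30); p.441 (PDF 31); (3.31) p.442 (PDF 32)].  Unit `lit-balaban-p39-g17` (Phase-2 proof
seat p39, gen 17); fold rows `B3.Eq3.25-3.32` (owner r15; r15 g14's residual list (α)(β)(γ), 2026-08-23).  statement-level skeleton of
published theorems with citation tags; proofs where landed; nothing here is a claim about the Yang–Mills mass gap.
v1.1 (p39 gen 22, 2026-08-23; DOC-ONLY, declarations byte-identical to v1.0 p349037; summit-lit1 g87 CITELOC #23 key
P87-001): the display (3.26) is printed on p. 440 [PDF 30] — the whole page is the display, the ν-weighted first curly bracket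
included; p. 441 [PDF 31] carries the Π^{(η,j₀)}_{μμ′ν}-form of that bracket, the rescaling display and (3.27)–(3.28).  Eight
citation tags of v1.0 attached the display number to page 441 instead; they now read «(3.26) p.440; p.441» (display locator,
then the page of the quoted p. 441 form).  Nothing else changed.

WHAT THE PRINT SAYS.  p. 440: *"Applying the same transformations as for (3.9), we get"* (3.26): the four vector self-energy graphs
`−T₁ + T₂ − T₃ − T₄` (two nonlocal ones with the kernels `tr q²(G^η_{(j)}(0)∂^{η*}_{μ′})(x,x′)(G^η_{(j′)}(0)∂^{η*}_μ)(x′,x)` and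
`tr q² G^η_{(j)}(0;x,x′)(∂^η_{μ′}G^η_{(j′)}(0)∂^{η*}_μ)(x′,x)`, two local ones with `G^η_{(j″)}(0;x,x)` and `η(G^η_{(j″)}(0)∂^{η*}_μ)(x,x)`)
`= [the same four terms with the leg g′A′_{μ′} localized at x] + {the Taylor term with (x′_ν − x_ν)(∂^η_ν g′A′_{μ′})(x)} + {the remainder
term}`; *"The expressions in the last curly bracket above are the generalized expressions of the same form as in (3.11) … The remaining
expressions are analyzed in the same way as the first term in (3.11). If j₀ denotes a smallest j-index of external legs, then we sum with
respect to j, j′, j″ from 0 to j₀ and we get the same expressions but with the propagator G_{j₀}(0). The expression in the square bracket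
on the right side of (3.26) has the form Σ_x η^d Σ_{μ,μ′} g(x)A_μ(x)Π^{(η,j₀)}_{μμ′}(x)g′(x)A′_{μ′}(x) …, and the expression in the first
curly bracket has the form Σ_ν Σ_x η^d Σ_{μ,μ′} g(x)A_μ(x)Π^{(η,j₀)}_{μμ′ν}(x)(∂^η_ν g′A′_{μ′})(x)"*; p. 441: *"Now let us rescale the
functions Π^{(η,j₀)}_{μμ′}, Π^{(η,j₀)}_{μμ′ν} from the η-lattice to the L^{−j₀}-lattice … We consider the case d = 3"*; p. 442, (3.31):
the degree-0 graphs are written as (a term with the weight `|x′ − x|^α` inserted and divided) + (a local term).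

WHAT THIS FILE PROVES (zero external field; the print's carrier for (3.4)–(3.38) is the infinite lattice, ROWS-B3 v1.207; p26's
`B3Ineq313Lattice.KernelZ d` vocabulary, finite localization sets `Λ ∋ x`, `Λ′ ∋ x′` as in p26's (3.9)/(3.11) files):
* §1 (any `d`) the kernels `dAdjKernelZ` (`G∂^{η*}_μ`), `d2KernelZ` (`∂^η_{μ′}G∂^{η*}_μ`; its diagonal is p26's `dKernelZ`, `rfl`), the
  graph kernels `kerAZ`, `kerBZ`, `kerCZ`, the pairing `pairSumZ`, legs `legFarZ`/`legNearZ`, and the printed objects `lhs326Z`,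
  `bracket326Z`, `curly1Z`, `curly2Z` (lattice twins of r15's torus `B3Sect3VectorSelfEnergy.kerA … curly2`), with their algebra;
* §2 (any `d`) **`eq326Z` — (3.26) PROVED WITH NO HYPOTHESIS** on `ηℤ^{d+1}`: Taylor's formula (3.10) for the leg `g′A′_{μ′}` is p26's
  `B3Taylor310Lattice.taylor310` (forward reading; derivative leg `∂^η_ν(g′A′_{μ′}) = pd η⁻¹ ν (g′A′_{μ′})`, remainder leg `rem η⁻¹ (g′A′_{μ′})`);
  and THE RESUMMATION SENTENCE of p. 440: `graphs326Z_resum`, `curly1Z_resum`, `local326Z_resum`, `lhs326Z_resum` — summing over the line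
  indices gives the same expressions with the resummed propagator in every slot (multilinearity; the identification of the resummed
  propagator with the `η`-lattice reading `GetaL ℓ j₀ k` of the `j₀`-th-step propagator is the scale dictionary of p39's
  `B3GscaleLatRescaling`, not repeated here);
* §3 (`d = 3`) the DICTIONARY to gen 9's infinite-lattice kernels (`kerCZ_eq_nonloc`, `kerCZ_disp_eq_nonloc3`), the p. 440/441 forms
  `piForm2` (with `B3Pi2ZeroLattice.Pi2L`) and `piForm3` (with `B3Pi3ZeroLattice.Pi3L`), **`tendsto_bracket326Z` / `tendsto_curly1Z`**: the
  square bracket and the first curly bracket CONVERGE TO THESE FORMS AS `Λ′ ↑ ℤ³` whenever the integrands are summable, the summability for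
  `G^ξ_{j₀}(0)` and `G^η_{j₀}(0)` (`summable_nonloc_GxiL`, `summable_nonloc3_GxiL`, `summable_nonloc_GetaL`, `summable_nonloc3_GetaL`, from gen 9's
  `exists_bounds` and gen 11's `nonloc_rescale`), the instance `tendsto_bracket326Z_curly1Z_GetaL`, the p. 441 RESCALING DISPLAY
  `piForms_GetaL_rescale` (by gen 11's `B3Eq330EtaZeroLattice.Pi2L_eta_eq` / `Pi3L_eta_eq`, i.e. the lattice rescaling lemmas
  `Pi2L_rescale` / `Pi3L_rescale`), the coefficient bounds `piForms_GetaL_coefficients` (gen 11's `eq330_coefficients_zero_lattice`), and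
  the assembled statement **`eq326_zeroLattice`**;
* §4 (any `d`) **`eq331Z` — (3.31) PROVED** on `ηℤ^{d+1}` (add and subtract; weight `(η·dist₁(x,x′))^α` with p26's `ℓ¹` lattice distance,
  any real `α`, `η > 0`), its weight-generic form `eq331Z_of_weight`, and `tendsto_local331Z`: the local term with the `x′`-sum over the
  whole lattice as the `Λ′ ↑ ℤ^{d+1}` limit under row-summability of the kernel.

HONEST SCOPE.  (δ) The LAST curly bracket of (3.26) is DEFINED (`curly2Z`, remainder leg) and enters `eq326Z`, but its (3.13)/(3.14)-type
bound (*"generalized expressions … positive degree −d + 3 + α … Proposition 2.2 can be applied"*) is NOT proved here.  (ε) The pictures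
(3.30)/(3.32) as drawn objects are not touched.  The torus/box versions are r15's `B3Sect3VectorSelfEnergy` (there (3.10) is a hypothesis
of `eq326`).  `d`-scope: §§1, 2, 4 are dimension-free; §3 is `d = 3` (the Π-kernels of the `B3Pi2ZeroLattice` lineage are typed on `ℤ³`,
and p. 441 *"We consider the case d = 3"*).  Definitions with bodies and theorems; no named facts; standard axioms.
-/

open scoped BigOperators
open Finset Filter Topology

namespace Literature.MathematicalPhysics.QuantumFieldTheory.Balaban1983to89.B3Eq326ZeroLattice

open B3Sect3VectorSelfEnergy (ZSite unitVec Cxi)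
open B3Eq316ResolventZeroLattice (xiOf GxiL MxiL xiOf_pos xiOf_le_one)
open B3Eq316DifferenceKernelBounds (prof dK2 d2K exists_bounds)
open B3Pi2ZeroLattice (nonloc Pi2L nonloc_add_left nonloc_add_right summable_nonloc_conv_conv tsum_nonloc_conv_M_bound
  tsum_nonloc_M_G_bound GxiL_eq_conv_add)
open B3Pi3ZeroLattice (nonloc3 Pi3L nonloc3_add_left nonloc3_add_right summable_nonloc3_conv_conv tsum_nonloc3_conv_M_bound
  tsum_nonloc3_M_G_bound)
open B3Eq330EtaZeroLattice (scale330 GetaL scale330_pos xiOf_eq_scale_mul GetaL_eq nonloc_rescale nonloc3_rescale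
  Pi2L_eta_eq Pi3L_eta_eq eq330_coefficients_zero_lattice)
open B3Taylor310Lattice (pd lin rem dist₁ taylor310)
open B3Ineq313Lattice (KernelZ dKernelZ)
open _root_.Filter

noncomputable section

/-! ## §1 The kernels of `G∂^{η*}_μ` and `∂^η_{μ′}G∂^{η*}_μ` on `ηℤ^{d+1}` and the four graphs of (3.26) -/

section Kernels

variable {d : ℕ}

/-- The kernel `(G∂^{η*}_μ)(y,x′) = c(G(y,x′+e_μ) − G(y,x′))`, `c = η^{−1}`, on `ηℤ^{d+1}` (twin of r15's torus
`B3Sect3VectorSelfEnergy.dAdjKernel`; at `d + 1 = 3` it is gen 9's `dK2 η`, `dAdjKernelZ_eq_dK2`). [cite: Balaban1983Higgs3, (3.26) p.440] -/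
def dAdjKernelZ (c : ℝ) (μ : Fin (d + 1)) (G : KernelZ d) : KernelZ d :=
  fun y x' => c * (G y (x' + Pi.single μ 1) - G y x')

/-- The kernel `(∂^η_{μ′}G∂^{η*}_μ)(x,x′) = c²[G(x+e_{μ′},x′+e_μ) − G(x+e_{μ′},x′) − G(x,x′+e_μ) + G(x,x′)]`, `c = η^{−1}`, on `ηℤ^{d+1}`
(twin of the torus `d2Kernel`; its diagonal `μ′ = μ` is p26's `B3Ineq313Lattice.dKernelZ`). [cite: Balaban1983Higgs3, (3.26) p.440] -/
def d2KernelZ (c : ℝ) (μ' μ : Fin (d + 1)) (G : KernelZ d) : KernelZ d :=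
  fun x x' => c ^ 2 * (G (x + Pi.single μ' 1) (x' + Pi.single μ 1) - G (x + Pi.single μ' 1) x' - G x (x' + Pi.single μ 1) + G x x')

/-- kernel: on the diagonal the mixed kernel is p26's `dKernelZ` of (3.9). [cite: Balaban1983Higgs3, (3.26) p.440] -/
theorem d2KernelZ_diag (c : ℝ) (μ : Fin (d + 1)) (G : KernelZ d) : d2KernelZ c μ μ G = dKernelZ c μ G := rfl

/-- The kernel of the first graph of (3.26): `tr q²(G^η_{(j)}(0)∂^{η*}_{μ′})(x,x′)(G^η_{(j′)}(0)∂^{η*}_μ)(x′,x)` (`τ = tr q²`).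
[cite: Balaban1983Higgs3, (3.26) p.440] -/
def kerAZ (η τ : ℝ) (Gj Gj' : KernelZ d) (μ μ' : Fin (d + 1)) : KernelZ d :=
  fun x x' => τ * (dAdjKernelZ η⁻¹ μ' Gj x x' * dAdjKernelZ η⁻¹ μ Gj' x' x)

/-- The kernel of the second graph of (3.26): `tr q² G^η_{(j)}(0;x,x′)(∂^η_{μ′}G^η_{(j′)}(0)∂^{η*}_μ)(x′,x)`.
[cite: Balaban1983Higgs3, (3.26) p.440] -/
def kerBZ (η τ : ℝ) (Gj Gj' : KernelZ d) (μ μ' : Fin (d + 1)) : KernelZ d :=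
  fun x x' => τ * (Gj x x' * d2KernelZ η⁻¹ μ' μ Gj' x' x)

/-- The combined kernel of the curly brackets of (3.26): `tr q²[−(G∂^{η*}_{μ′})(x,x′)(G∂^{η*}_μ)(x′,x) + G(x,x′)(∂^η_{μ′}G∂^{η*}_μ)(x′,x)]`.
[cite: Balaban1983Higgs3, (3.26) p.440] -/
def kerCZ (η τ : ℝ) (Gj Gj' : KernelZ d) (μ μ' : Fin (d + 1)) : KernelZ d :=
  fun x x' => -kerAZ η τ Gj Gj' μ μ' x x' + kerBZ η τ Gj Gj' μ μ' x x'

/-- The generic two-leg pairing of (3.26) on `ηℤ^{d+1}` with finite localization sets `Λ ∋ x`, `Λ′ ∋ x′`: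
`Σ_{x∈Λ,x′∈Λ′} η^{2d} Σ_{μ,μ′} g(x)A_μ(x)·K_{μμ′}(x,x′)·F_{μ′}(x,x′)` (vector legs `A μ x = A_μ(x)`; second leg `F` read at `(x,x′)`).
[cite: Balaban1983Higgs3, (3.26) p.440] -/
def pairSumZ (η : ℝ) (K : Fin (d + 1) → Fin (d + 1) → KernelZ d) (g : (Fin (d + 1) → ℤ) → ℝ)
    (A : Fin (d + 1) → (Fin (d + 1) → ℤ) → ℝ) (F : Fin (d + 1) → (Fin (d + 1) → ℤ) → (Fin (d + 1) → ℤ) → ℝ)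
    (Λ Λ' : Finset (Fin (d + 1) → ℤ)) : ℝ :=
  ∑ x ∈ Λ, ∑ x' ∈ Λ', η ^ (2 * (d + 1)) *
    ∑ μ : Fin (d + 1), ∑ μ' : Fin (d + 1), g x * A μ x * K μ μ' x x' * F μ' x x'

/-- The nonlocal reading of the second leg, `F_{μ′}(x,x′) = g′(x′)A′_{μ′}(x′)` (left side of (3.26)). [cite: Balaban1983Higgs3, (3.26) p.440] -/
def legFarZ (g' : (Fin (d + 1) → ℤ) → ℝ) (A' : Fin (d + 1) → (Fin (d + 1) → ℤ) → ℝ) :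
    Fin (d + 1) → (Fin (d + 1) → ℤ) → (Fin (d + 1) → ℤ) → ℝ :=
  fun μ' _ x' => g' x' * A' μ' x'

/-- The localized reading `F_{μ′}(x,x′) = g′(x)A′_{μ′}(x)` (square bracket of (3.26)). [cite: Balaban1983Higgs3, (3.26) p.440] -/
def legNearZ (g' : (Fin (d + 1) → ℤ) → ℝ) (A' : Fin (d + 1) → (Fin (d + 1) → ℤ) → ℝ) :
    Fin (d + 1) → (Fin (d + 1) → ℤ) → (Fin (d + 1) → ℤ) → ℝ :=
  fun μ' x _ => g' x * A' μ' x

/-- The two nonlocal graphs of (3.26) with the signs of the print, for a second leg `F`: `−T₁ + T₂`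
`= −(pairing with kerA) + (pairing with kerB)`. [cite: Balaban1983Higgs3, (3.26) p.440] -/
def graphs326Z (η τ : ℝ) (Gj Gj' : KernelZ d) (g : (Fin (d + 1) → ℤ) → ℝ) (A : Fin (d + 1) → (Fin (d + 1) → ℤ) → ℝ)
    (F : Fin (d + 1) → (Fin (d + 1) → ℤ) → (Fin (d + 1) → ℤ) → ℝ) (Λ Λ' : Finset (Fin (d + 1) → ℤ)) : ℝ :=
  -pairSumZ η (kerAZ η τ Gj Gj') g A F Λ Λ' + pairSumZ η (kerBZ η τ Gj Gj') g A F Λ Λ'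

/-- The two local graphs of (3.26) without their signs, `T₃ + T₄`:
`Σ_{x∈Λ} η^d Σ_μ g(x)A_μ(x)g′(x)A′_μ(x)·tr q²[G^η_{(j″)}(0;x,x) + η(G^η_{(j″)}(0)∂^{η*}_μ)(x,x)]`. [cite: Balaban1983Higgs3, (3.26) p.440] -/
def local326Z (η τ : ℝ) (Gj'' : KernelZ d) (g g' : (Fin (d + 1) → ℤ) → ℝ) (A A' : Fin (d + 1) → (Fin (d + 1) → ℤ) → ℝ)
    (Λ : Finset (Fin (d + 1) → ℤ)) : ℝ :=
  ∑ x ∈ Λ, η ^ (d + 1) * ∑ μ : Fin (d + 1),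
    g x * A μ x * g' x * A' μ x * (τ * Gj'' x x + τ * (η * dAdjKernelZ η⁻¹ μ Gj'' x x))

/-- **(3.26)** p. 440 [PDF 30], LEFT SIDE on `ηℤ^{d+1}`: `−T₁ + T₂ − T₃ − T₄` (the two nonlocal graphs with the leg `g′(x′)A′_{μ′}(x′)`,
the two local ones), localization sets `Λ ∋ x`, `Λ′ ∋ x′`. [cite: Balaban1983Higgs3, (3.26) p.440] -/
def lhs326Z (η τ : ℝ) (Gj Gj' Gj'' : KernelZ d) (g g' : (Fin (d + 1) → ℤ) → ℝ)
    (A A' : Fin (d + 1) → (Fin (d + 1) → ℤ) → ℝ) (Λ Λ' : Finset (Fin (d + 1) → ℤ)) : ℝ :=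
  graphs326Z η τ Gj Gj' g A (legFarZ g' A') Λ Λ' - local326Z η τ Gj'' g g' A A' Λ

/-- **(3.26)**, the SQUARE BRACKET of the right side: the same four terms with the leg `g′A′_{μ′}` localized at `x`
(read `[−T₁′ + T₂′ − T₃ − T₄]`, as r15's torus `bracket326`). [cite: Balaban1983Higgs3, (3.26) p.440] -/
def bracket326Z (η τ : ℝ) (Gj Gj' Gj'' : KernelZ d) (g g' : (Fin (d + 1) → ℤ) → ℝ)
    (A A' : Fin (d + 1) → (Fin (d + 1) → ℤ) → ℝ) (Λ Λ' : Finset (Fin (d + 1) → ℤ)) : ℝ :=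
  graphs326Z η τ Gj Gj' g A (legNearZ g' A') Λ Λ' - local326Z η τ Gj'' g g' A A' Λ

/-- **(3.26)**, the FIRST CURLY BRACKET: `Σ_ν Σ_{x,x′} η^{2d} Σ_{μ,μ′} g(x)A_μ(x)·tr q²[−(…) + (…)](x′_ν − x_ν)·(∂^η_ν g′A′_{μ′})(x)`
(`x′_ν − x_ν = η·(x′_ν − x_ν)` in lattice units; `D ν μ′ = ∂^η_ν(g′A′_{μ′})`). [cite: Balaban1983Higgs3, (3.26) p.440] -/
def curly1Z (η τ : ℝ) (Gj Gj' : KernelZ d) (g : (Fin (d + 1) → ℤ) → ℝ) (A : Fin (d + 1) → (Fin (d + 1) → ℤ) → ℝ)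
    (D : Fin (d + 1) → Fin (d + 1) → (Fin (d + 1) → ℤ) → ℝ) (Λ Λ' : Finset (Fin (d + 1) → ℤ)) : ℝ :=
  ∑ ν : Fin (d + 1), pairSumZ η (fun μ μ' x x' => kerCZ η τ Gj Gj' μ μ' x x' * (η * ((x' ν - x ν : ℤ) : ℝ))) g A
    (fun μ' x _ => D ν μ' x) Λ Λ'

/-- **(3.26)**, the LAST CURLY BRACKET: `Σ_{x,x′} η^{2d} Σ_{μ,μ′} g(x)A_μ(x)·tr q²[−(…) + (…)]·R_{μ′}(x,x′)`, `R_{μ′}` = the remainder of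
Taylor's formula (3.10) for the leg `g′A′_{μ′}` along `Γ_{x,x′}` (the printed `|x′ − x|^{1+α}` inserted and divided is not
performed, as on the torus). [cite: Balaban1983Higgs3, (3.26) p.440] -/
def curly2Z (η τ : ℝ) (Gj Gj' : KernelZ d) (g : (Fin (d + 1) → ℤ) → ℝ) (A : Fin (d + 1) → (Fin (d + 1) → ℤ) → ℝ)
    (R : Fin (d + 1) → (Fin (d + 1) → ℤ) → (Fin (d + 1) → ℤ) → ℝ) (Λ Λ' : Finset (Fin (d + 1) → ℤ)) : ℝ :=
  pairSumZ η (kerCZ η τ Gj Gj') g A R Λ Λ'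

/-! ### algebra of the pairing -/

/-- kernel: the pairing is additive in the second leg. [cite: Balaban1983Higgs3, (3.26) p.440] -/
theorem pairSumZ_add_leg (η : ℝ) (K : Fin (d + 1) → Fin (d + 1) → KernelZ d) (g : (Fin (d + 1) → ℤ) → ℝ)
    (A : Fin (d + 1) → (Fin (d + 1) → ℤ) → ℝ) (F F' : Fin (d + 1) → (Fin (d + 1) → ℤ) → (Fin (d + 1) → ℤ) → ℝ)
    (Λ Λ' : Finset (Fin (d + 1) → ℤ)) :
    pairSumZ η K g A (fun μ' x x' => F μ' x x' + F' μ' x x') Λ Λ' = pairSumZ η K g A F Λ Λ' + pairSumZ η K g A F' Λ Λ' := by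
  simp only [pairSumZ, mul_add, Finset.sum_add_distrib]

/-- kernel: the pairing with the zero leg vanishes. [cite: Balaban1983Higgs3, (3.26) p.440] -/
theorem pairSumZ_zero_leg (η : ℝ) (K : Fin (d + 1) → Fin (d + 1) → KernelZ d) (g : (Fin (d + 1) → ℤ) → ℝ)
    (A : Fin (d + 1) → (Fin (d + 1) → ℤ) → ℝ) (Λ Λ' : Finset (Fin (d + 1) → ℤ)) :
    pairSumZ η K g A (fun _ _ _ => 0) Λ Λ' = 0 := by
  simp [pairSumZ]

/-- kernel: the pairing of a finite sum of legs is the sum of the pairings. [cite: Balaban1983Higgs3, (3.26) p.440] -/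
theorem pairSumZ_sum_leg {ι : Type*} (T : Finset ι) (η : ℝ) (K : Fin (d + 1) → Fin (d + 1) → KernelZ d)
    (g : (Fin (d + 1) → ℤ) → ℝ) (A : Fin (d + 1) → (Fin (d + 1) → ℤ) → ℝ)
    (F : ι → Fin (d + 1) → (Fin (d + 1) → ℤ) → (Fin (d + 1) → ℤ) → ℝ) (Λ Λ' : Finset (Fin (d + 1) → ℤ)) :
    pairSumZ η K g A (fun μ' x x' => ∑ ν ∈ T, F ν μ' x x') Λ Λ' = ∑ ν ∈ T, pairSumZ η K g A (F ν) Λ Λ' := by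
  classical
  induction T using Finset.induction_on with
  | empty => simp only [Finset.sum_empty]; exact pairSumZ_zero_leg η K g A Λ Λ'
  | insert i T hi ih =>
      simp only [Finset.sum_insert hi]
      rw [← ih, ← pairSumZ_add_leg]

/-- kernel: the pairing is additive in the kernel. [cite: Balaban1983Higgs3, (3.26) p.440] -/
theorem pairSumZ_add_ker (η : ℝ) (K K' : Fin (d + 1) → Fin (d + 1) → KernelZ d) (g : (Fin (d + 1) → ℤ) → ℝ)
    (A : Fin (d + 1) → (Fin (d + 1) → ℤ) → ℝ) (F : Fin (d + 1) → (Fin (d + 1) → ℤ) → (Fin (d + 1) → ℤ) → ℝ)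
    (Λ Λ' : Finset (Fin (d + 1) → ℤ)) :
    pairSumZ η (fun μ μ' x x' => K μ μ' x x' + K' μ μ' x x') g A F Λ Λ' = pairSumZ η K g A F Λ Λ' + pairSumZ η K' g A F Λ Λ' := by
  simp only [pairSumZ, mul_add, add_mul, Finset.sum_add_distrib]

/-- kernel: the pairing is homogeneous in the kernel (sign). [cite: Balaban1983Higgs3, (3.26) p.440] -/
theorem pairSumZ_neg_ker (η : ℝ) (K : Fin (d + 1) → Fin (d + 1) → KernelZ d) (g : (Fin (d + 1) → ℤ) → ℝ)
    (A : Fin (d + 1) → (Fin (d + 1) → ℤ) → ℝ) (F : Fin (d + 1) → (Fin (d + 1) → ℤ) → (Fin (d + 1) → ℤ) → ℝ)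
    (Λ Λ' : Finset (Fin (d + 1) → ℤ)) :
    pairSumZ η (fun μ μ' x x' => -K μ μ' x x') g A F Λ Λ' = -pairSumZ η K g A F Λ Λ' := by
  simp only [pairSumZ, mul_neg, neg_mul, Finset.sum_neg_distrib]

/-- kernel: the pairing of a finite sum of kernels is the sum of the pairings. [cite: Balaban1983Higgs3, (3.26) p.440] -/
theorem pairSumZ_sum_ker {ι : Type*} (S : Finset ι) (η : ℝ) (K : ι → Fin (d + 1) → Fin (d + 1) → KernelZ d)
    (g : (Fin (d + 1) → ℤ) → ℝ) (A : Fin (d + 1) → (Fin (d + 1) → ℤ) → ℝ)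
    (F : Fin (d + 1) → (Fin (d + 1) → ℤ) → (Fin (d + 1) → ℤ) → ℝ) (Λ Λ' : Finset (Fin (d + 1) → ℤ)) :
    pairSumZ η (fun μ μ' x x' => ∑ i ∈ S, K i μ μ' x x') g A F Λ Λ' = ∑ i ∈ S, pairSumZ η (K i) g A F Λ Λ' := by
  classical
  induction S using Finset.induction_on with
  | empty => simp [pairSumZ]
  | insert i S hi ih =>
      simp only [Finset.sum_insert hi]
      rw [← ih, ← pairSumZ_add_ker]

/-- kernel: the two nonlocal graphs are the pairing with the combined kernel. [cite: Balaban1983Higgs3, (3.26) p.440] -/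
theorem graphs326Z_eq_pairSumZ_kerCZ (η τ : ℝ) (Gj Gj' : KernelZ d) (g : (Fin (d + 1) → ℤ) → ℝ)
    (A : Fin (d + 1) → (Fin (d + 1) → ℤ) → ℝ) (F : Fin (d + 1) → (Fin (d + 1) → ℤ) → (Fin (d + 1) → ℤ) → ℝ)
    (Λ Λ' : Finset (Fin (d + 1) → ℤ)) :
    graphs326Z η τ Gj Gj' g A F Λ Λ' = pairSumZ η (kerCZ η τ Gj Gj') g A F Λ Λ' := by
  have h : kerCZ η τ Gj Gj' = fun μ μ' x x' => (fun μ μ' x x' => -kerAZ η τ Gj Gj' μ μ' x x') μ μ' x x' +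
      kerBZ η τ Gj Gj' μ μ' x x' := by
    funext μ μ' x x'; rfl
  rw [h, pairSumZ_add_ker, pairSumZ_neg_ker, graphs326Z]

/-- kernel: a pairing whose second leg is read at `x` only collapses its `x′`-sum onto the kernel:
`Σ_{x,x′}η^{2d}Σ_{μμ′} gA_μ(x)K_{μμ′}(x,x′)F_{μ′}(x) = Σ_xη^dΣ_{μμ′} gA_μ(x)(Σ_{x′∈Λ′}η^dK_{μμ′}(x,x′))F_{μ′}(x)`.
[cite: Balaban1983Higgs3, (3.26) p.440] -/
theorem pairSumZ_local (η : ℝ) (K : Fin (d + 1) → Fin (d + 1) → KernelZ d) (g : (Fin (d + 1) → ℤ) → ℝ)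
    (A : Fin (d + 1) → (Fin (d + 1) → ℤ) → ℝ) (Fl : Fin (d + 1) → (Fin (d + 1) → ℤ) → ℝ) (Λ Λ' : Finset (Fin (d + 1) → ℤ)) :
    pairSumZ η K g A (fun μ' x _ => Fl μ' x) Λ Λ' =
      ∑ x ∈ Λ, η ^ (d + 1) * ∑ μ : Fin (d + 1), ∑ μ' : Fin (d + 1),
        g x * A μ x * (∑ x' ∈ Λ', η ^ (d + 1) * K μ μ' x x') * Fl μ' x := by
  simp only [pairSumZ, Finset.mul_sum, Finset.sum_mul]
  refine Finset.sum_congr rfl fun x _ => ?_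
  rw [Finset.sum_comm]
  refine Finset.sum_congr rfl fun μ _ => ?_
  rw [Finset.sum_comm]
  refine Finset.sum_congr rfl fun μ' _ => Finset.sum_congr rfl fun x' _ => ?_
  rw [two_mul, pow_add]
  ring

/-- kernel: the first curly bracket is the pairing with the combined kernel and the Taylor leg `Σ_ν(x′_ν − x_ν)D_ν`.
[cite: Balaban1983Higgs3, (3.26) p.440] -/
theorem curly1Z_eq_pairSumZ (η τ : ℝ) (Gj Gj' : KernelZ d) (g : (Fin (d + 1) → ℤ) → ℝ)
    (A : Fin (d + 1) → (Fin (d + 1) → ℤ) → ℝ) (D : Fin (d + 1) → Fin (d + 1) → (Fin (d + 1) → ℤ) → ℝ)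
    (Λ Λ' : Finset (Fin (d + 1) → ℤ)) :
    curly1Z η τ Gj Gj' g A D Λ Λ' = pairSumZ η (kerCZ η τ Gj Gj') g A
      (fun μ' x x' => ∑ ν : Fin (d + 1), η * ((x' ν - x ν : ℤ) : ℝ) * D ν μ' x) Λ Λ' := by
  rw [pairSumZ_sum_leg, curly1Z]
  refine Finset.sum_congr rfl fun ν _ => ?_
  simp only [pairSumZ]
  refine Finset.sum_congr rfl fun x _ => Finset.sum_congr rfl fun x' _ => ?_
  congr 1
  refine Finset.sum_congr rfl fun μ _ => Finset.sum_congr rfl fun μ' _ => ?_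
  ring

end Kernels

/-! ## §2 (3.26) on `ηℤ^{d+1}`, PROVED by Taylor's formula (3.10) for the leg `g′A′_{μ′}` -/

section Eq326

variable {d : ℕ}

/-- **(3.26)** p. 440 [PDF 30] ON THE PRINT'S CARRIER `ηℤ^{d+1}` (the pieces `G^η_{(j)}(0)` of `G_k(ηℤ^{d+1},0)`, background-free
vector legs `gA`, `g′A′`, finite localization sets `Λ ∋ x`, `Λ′ ∋ x′`), PROVED WITH NO HYPOTHESIS — *"Applying the same transformations as
for (3.9), we get"* `(left side) = [square bracket] + {first curly bracket} + {last curly bracket}`: Taylor's formula (3.10)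
(`B3Taylor310Lattice.taylor310`, forward reading, `η⁻¹⁻¹ = η`) applied to the leg `x′ ↦ g′(x′)A′_{μ′}(x′)` inside the pairing with the
combined kernel, the derivative leg being `D ν μ′ = ∂^η_ν(g′A′_{μ′})` and the remainder leg `R_{μ′}(x,x′) = rem(g′A′_{μ′})(x,x′)` (r15's
torus `B3Sect3VectorSelfEnergy.eq326` is the finite-volume twin, there with (3.10) as a hypothesis). [cite: Balaban1983Higgs3, (3.26) p.440] -/
theorem eq326Z (η τ : ℝ) (Gj Gj' Gj'' : KernelZ d) (g g' : (Fin (d + 1) → ℤ) → ℝ)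
    (A A' : Fin (d + 1) → (Fin (d + 1) → ℤ) → ℝ) (Λ Λ' : Finset (Fin (d + 1) → ℤ)) :
    lhs326Z η τ Gj Gj' Gj'' g g' A A' Λ Λ' =
      bracket326Z η τ Gj Gj' Gj'' g g' A A' Λ Λ' +
        curly1Z η τ Gj Gj' g A (fun ν μ' x => pd η⁻¹ ν (fun z => g' z * A' μ' z) x) Λ Λ' +
        curly2Z η τ Gj Gj' g A (fun μ' x x' => rem η⁻¹ (fun z => g' z * A' μ' z) x x') Λ Λ' := by
  -- Taylor's formula (3.10) for the leg `g′A′_{μ′}`, forward reading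
  have hT : ∀ (μ' : Fin (d + 1)) (x x' : Fin (d + 1) → ℤ), g' x' * A' μ' x' =
      g' x * A' μ' x + (∑ ν : Fin (d + 1), η * ((x' ν - x ν : ℤ) : ℝ) * pd η⁻¹ ν (fun z => g' z * A' μ' z) x) +
        rem η⁻¹ (fun z => g' z * A' μ' z) x x' := by
    intro μ' x x'
    have h := taylor310 η⁻¹ (fun z => g' z * A' μ' z) x x'
    simp only [lin, inv_inv, smul_eq_mul] at h
    exact h
  have hleg : legFarZ g' A' = fun μ' x x' =>
      (legNearZ g' A' μ' x x' + ∑ ν : Fin (d + 1), η * ((x' ν - x ν : ℤ) : ℝ) * pd η⁻¹ ν (fun z => g' z * A' μ' z) x) +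
        rem η⁻¹ (fun z => g' z * A' μ' z) x x' := by
    funext μ' x x'
    exact hT μ' x x'
  have hsplit : pairSumZ η (kerCZ η τ Gj Gj') g A (legFarZ g' A') Λ Λ' =
      pairSumZ η (kerCZ η τ Gj Gj') g A (legNearZ g' A') Λ Λ' +
        pairSumZ η (kerCZ η τ Gj Gj') g A
          (fun μ' x x' => ∑ ν : Fin (d + 1), η * ((x' ν - x ν : ℤ) : ℝ) * pd η⁻¹ ν (fun z => g' z * A' μ' z) x) Λ Λ' +
        pairSumZ η (kerCZ η τ Gj Gj') g A (fun μ' x x' => rem η⁻¹ (fun z => g' z * A' μ' z) x x') Λ Λ' := by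
    rw [hleg, pairSumZ_add_leg, pairSumZ_add_leg]
  rw [lhs326Z, bracket326Z, graphs326Z_eq_pairSumZ_kerCZ, graphs326Z_eq_pairSumZ_kerCZ, hsplit, curly1Z_eq_pairSumZ, curly2Z]
  ring

/-! ### p. 440: *"we sum with respect to j, j′, j″ … and we get the same expressions but with the propagator G_{j₀}(0)"* —
the four graphs are bilinear / linear in their propagators -/

/-- kernel: `(G∂^{η*}_μ)` is additive in `G`. [cite: Balaban1983Higgs3, (3.26) p.440] -/
theorem dAdjKernelZ_add (c : ℝ) (μ : Fin (d + 1)) (K M : KernelZ d) (x x' : Fin (d + 1) → ℤ) :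
    dAdjKernelZ c μ (K + M) x x' = dAdjKernelZ c μ K x x' + dAdjKernelZ c μ M x x' := by
  simp only [dAdjKernelZ, Pi.add_apply]; ring

/-- kernel: `(∂^η_{μ′}G∂^{η*}_μ)` is additive in `G`. [cite: Balaban1983Higgs3, (3.26) p.440] -/
theorem d2KernelZ_add (c : ℝ) (μ' μ : Fin (d + 1)) (K M : KernelZ d) (x x' : Fin (d + 1) → ℤ) :
    d2KernelZ c μ' μ (K + M) x x' = d2KernelZ c μ' μ K x x' + d2KernelZ c μ' μ M x x' := by
  simp only [d2KernelZ, Pi.add_apply]; ring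

/-- kernel: `(G∂^{η*}_μ)` of a finite sum. [cite: Balaban1983Higgs3, (3.26) p.440] -/
theorem dAdjKernelZ_sum {ι : Type*} (S : Finset ι) (G : ι → KernelZ d) (c : ℝ) (μ : Fin (d + 1)) (x x' : Fin (d + 1) → ℤ) :
    dAdjKernelZ c μ (∑ i ∈ S, G i) x x' = ∑ i ∈ S, dAdjKernelZ c μ (G i) x x' := by
  simp only [dAdjKernelZ, Finset.sum_apply, Finset.mul_sum, ← Finset.sum_sub_distrib]

/-- kernel: `(∂G∂^*)` of a finite sum. [cite: Balaban1983Higgs3, (3.26) p.440] -/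
theorem d2KernelZ_sum {ι : Type*} (S : Finset ι) (G : ι → KernelZ d) (c : ℝ) (μ' μ : Fin (d + 1)) (x x' : Fin (d + 1) → ℤ) :
    d2KernelZ c μ' μ (∑ i ∈ S, G i) x x' = ∑ i ∈ S, d2KernelZ c μ' μ (G i) x x' := by
  simp only [d2KernelZ, Finset.sum_apply, Finset.mul_sum, ← Finset.sum_sub_distrib, ← Finset.sum_add_distrib]

/-- kernel: the first graph's kernel is bilinear — of two finite sums it is the double sum. [cite: Balaban1983Higgs3, (3.26) p.440] -/
theorem kerAZ_sum_sum {ι ι' : Type*} (S : Finset ι) (S' : Finset ι') (G : ι → KernelZ d) (G' : ι' → KernelZ d) (η τ : ℝ)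
    (μ μ' : Fin (d + 1)) (x x' : Fin (d + 1) → ℤ) :
    kerAZ η τ (∑ i ∈ S, G i) (∑ i' ∈ S', G' i') μ μ' x x' = ∑ i ∈ S, ∑ i' ∈ S', kerAZ η τ (G i) (G' i') μ μ' x x' := by
  simp only [kerAZ, dAdjKernelZ_sum, Finset.sum_mul, Finset.mul_sum]
  exact Finset.sum_comm

/-- kernel: the second graph's kernel is bilinear. [cite: Balaban1983Higgs3, (3.26) p.440] -/
theorem kerBZ_sum_sum {ι ι' : Type*} (S : Finset ι) (S' : Finset ι') (G : ι → KernelZ d) (G' : ι' → KernelZ d) (η τ : ℝ)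
    (μ μ' : Fin (d + 1)) (x x' : Fin (d + 1) → ℤ) :
    kerBZ η τ (∑ i ∈ S, G i) (∑ i' ∈ S', G' i') μ μ' x x' = ∑ i ∈ S, ∑ i' ∈ S', kerBZ η τ (G i) (G' i') μ μ' x x' := by
  simp only [kerBZ, d2KernelZ_sum, Finset.sum_apply, Finset.sum_mul, Finset.mul_sum]
  exact Finset.sum_comm

/-- kernel: the combined kernel is bilinear. [cite: Balaban1983Higgs3, (3.26) p.440] -/
theorem kerCZ_sum_sum {ι ι' : Type*} (S : Finset ι) (S' : Finset ι') (G : ι → KernelZ d) (G' : ι' → KernelZ d) (η τ : ℝ)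
    (μ μ' : Fin (d + 1)) (x x' : Fin (d + 1) → ℤ) :
    kerCZ η τ (∑ i ∈ S, G i) (∑ i' ∈ S', G' i') μ μ' x x' = ∑ i ∈ S, ∑ i' ∈ S', kerCZ η τ (G i) (G' i') μ μ' x x' := by
  simp only [kerCZ, kerAZ_sum_sum, kerBZ_sum_sum, Finset.sum_neg_distrib, Finset.sum_add_distrib]

/-- **THE RESUMMATION OF THE TWO NONLOCAL GRAPHS** (p. 440): `Σ_{j∈S,j′∈S′}(−T₁ + T₂)[G_j, G′_{j′}] = (−T₁ + T₂)[Σ_jG_j, Σ_{j′}G′_{j′}]`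
for every second leg `F` — in particular for the left side, the square bracket (`F` = the localized leg) and both curly brackets.
[cite: Balaban1983Higgs3, (3.26) p.440] -/
theorem graphs326Z_resum {ι ι' : Type*} (S : Finset ι) (S' : Finset ι') (G : ι → KernelZ d) (G' : ι' → KernelZ d) (η τ : ℝ)
    (g : (Fin (d + 1) → ℤ) → ℝ) (A : Fin (d + 1) → (Fin (d + 1) → ℤ) → ℝ)
    (F : Fin (d + 1) → (Fin (d + 1) → ℤ) → (Fin (d + 1) → ℤ) → ℝ) (Λ Λ' : Finset (Fin (d + 1) → ℤ)) :
    ∑ i ∈ S, ∑ i' ∈ S', graphs326Z η τ (G i) (G' i') g A F Λ Λ' = graphs326Z η τ (∑ i ∈ S, G i) (∑ i' ∈ S', G' i') g A F Λ Λ' := by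
  simp only [graphs326Z_eq_pairSumZ_kerCZ]
  have hK : kerCZ η τ (∑ i ∈ S, G i) (∑ i' ∈ S', G' i') =
      fun μ μ' x x' => ∑ i ∈ S, (fun i μ μ' x x' => ∑ i' ∈ S', kerCZ η τ (G i) (G' i') μ μ' x x') i μ μ' x x' := by
    funext μ μ' x x'; exact kerCZ_sum_sum S S' G G' η τ μ μ' x x'
  rw [hK, pairSumZ_sum_ker]
  refine Finset.sum_congr rfl fun i _ => ?_
  exact (pairSumZ_sum_ker S' η (fun i' => kerCZ η τ (G i) (G' i')) g A F Λ Λ').symm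

/-- **THE RESUMMATION OF THE FIRST CURLY BRACKET** (same bilinearity, with the displacement weight). [cite: Balaban1983Higgs3, (3.26) p.440] -/
theorem curly1Z_resum {ι ι' : Type*} (S : Finset ι) (S' : Finset ι') (G : ι → KernelZ d) (G' : ι' → KernelZ d) (η τ : ℝ)
    (g : (Fin (d + 1) → ℤ) → ℝ) (A : Fin (d + 1) → (Fin (d + 1) → ℤ) → ℝ) (D : Fin (d + 1) → Fin (d + 1) → (Fin (d + 1) → ℤ) → ℝ)
    (Λ Λ' : Finset (Fin (d + 1) → ℤ)) :
    ∑ i ∈ S, ∑ i' ∈ S', curly1Z η τ (G i) (G' i') g A D Λ Λ' = curly1Z η τ (∑ i ∈ S, G i) (∑ i' ∈ S', G' i') g A D Λ Λ' := by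
  simp only [curly1Z_eq_pairSumZ, ← graphs326Z_eq_pairSumZ_kerCZ]
  exact graphs326Z_resum S S' G G' η τ g A _ Λ Λ'

/-- kernel: the local graphs are additive in the propagator. [cite: Balaban1983Higgs3, (3.26) p.440] -/
theorem local326Z_add (η τ : ℝ) (K M : KernelZ d) (g g' : (Fin (d + 1) → ℤ) → ℝ) (A A' : Fin (d + 1) → (Fin (d + 1) → ℤ) → ℝ)
    (Λ : Finset (Fin (d + 1) → ℤ)) :
    local326Z η τ (K + M) g g' A A' Λ = local326Z η τ K g g' A A' Λ + local326Z η τ M g g' A A' Λ := by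
  simp only [local326Z, dAdjKernelZ_add, Pi.add_apply, ← Finset.sum_add_distrib, ← mul_add]
  refine Finset.sum_congr rfl fun x _ => ?_
  congr 1
  refine Finset.sum_congr rfl fun μ _ => ?_
  ring

/-- kernel: the local graphs of the zero propagator vanish. [cite: Balaban1983Higgs3, (3.26) p.440] -/
theorem local326Z_zero (η τ : ℝ) (g g' : (Fin (d + 1) → ℤ) → ℝ) (A A' : Fin (d + 1) → (Fin (d + 1) → ℤ) → ℝ)
    (Λ : Finset (Fin (d + 1) → ℤ)) : local326Z η τ (0 : KernelZ d) g g' A A' Λ = 0 := by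
  simp [local326Z, dAdjKernelZ]

/-- **THE RESUMMATION OF THE TWO LOCAL GRAPHS** (linearity in `G^η_{(j″)}(0)`). [cite: Balaban1983Higgs3, (3.26) p.440] -/
theorem local326Z_resum {ι : Type*} (S : Finset ι) (G : ι → KernelZ d) (η τ : ℝ) (g g' : (Fin (d + 1) → ℤ) → ℝ)
    (A A' : Fin (d + 1) → (Fin (d + 1) → ℤ) → ℝ) (Λ : Finset (Fin (d + 1) → ℤ)) :
    ∑ i ∈ S, local326Z η τ (G i) g g' A A' Λ = local326Z η τ (∑ i ∈ S, G i) g g' A A' Λ := by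
  classical
  induction S using Finset.induction_on with
  | empty => simp only [Finset.sum_empty]; exact (local326Z_zero η τ g g' A A' Λ).symm
  | insert i S hi ih => rw [Finset.sum_insert hi, Finset.sum_insert hi, local326Z_add, ih]

/-- **p. 440, THE RESUMMATION SENTENCE FOR (3.26)** — *"If j₀ denotes a smallest j-index of external legs, then we sum with respect to
j, j′, j″ … and we get the same expressions but with the propagator G_{j₀}(0)"*: summing the left side of (3.26) over the line
indices `j, j′ ∈ S` of the nonlocal graphs and `j″ ∈ S` of the local ones gives the left side of (3.26) with the RESUMMED propagator
`𝒢 = Σ_{j∈S}G^η_{(j)}(0)` in all three slots; the same for the square bracket and the curly brackets (`graphs326Z_resum`,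
`curly1Z_resum`, `local326Z_resum`). On the print's carrier `𝒢` is the partial sum of (2.6), identified with the `η`-lattice reading of
the `j₀`-th-step propagator by p39's `B3GscaleLatRescaling` (scale dictionary). [cite: Balaban1983Higgs3, (3.26) p.440] -/
theorem lhs326Z_resum {ι : Type*} (S : Finset ι) (G : ι → KernelZ d) (η τ : ℝ) (g g' : (Fin (d + 1) → ℤ) → ℝ)
    (A A' : Fin (d + 1) → (Fin (d + 1) → ℤ) → ℝ) (Λ Λ' : Finset (Fin (d + 1) → ℤ)) :
    (∑ j ∈ S, ∑ j' ∈ S, graphs326Z η τ (G j) (G j') g A (legFarZ g' A') Λ Λ') - ∑ j'' ∈ S, local326Z η τ (G j'') g g' A A' Λ =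
        lhs326Z η τ (∑ j ∈ S, G j) (∑ j ∈ S, G j) (∑ j ∈ S, G j) g g' A A' Λ Λ' ∧
      (∑ j ∈ S, ∑ j' ∈ S, graphs326Z η τ (G j) (G j') g A (legNearZ g' A') Λ Λ') - ∑ j'' ∈ S, local326Z η τ (G j'') g g' A A' Λ =
        bracket326Z η τ (∑ j ∈ S, G j) (∑ j ∈ S, G j) (∑ j ∈ S, G j) g g' A A' Λ Λ' := by
  refine ⟨?_, ?_⟩
  · rw [lhs326Z, graphs326Z_resum, local326Z_resum]
  · rw [bracket326Z, graphs326Z_resum, local326Z_resum]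

end Eq326

/-! ## §3 `d = 3`: the Λ′ ↑ ℤ³ limits of the square bracket and of the first curly bracket — the Π-forms of pp. 440–441 —
and their instance at the resummed propagator `G^η_{j₀}(0)` read on the `η`-lattice -/

section PiForms

/-- dictionary: at `d + 1 = 3` the kernel `(G∂^{η*}_μ)` is gen 9's `dK2 η`. [cite: Balaban1983Higgs3, (3.26) p.440] -/
theorem dAdjKernelZ_eq_dK2 (η : ℝ) (μ : Fin (2 + 1)) (G : KernelZ 2) (x x' : Fin (2 + 1) → ℤ) :
    dAdjKernelZ η⁻¹ μ G x x' = dK2 η μ G x x' := rfl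

/-- dictionary: at `d + 1 = 3` the kernel `(∂^η_{μ′}G∂^{η*}_μ)` is gen 9's `d2K η`. [cite: Balaban1983Higgs3, (3.26) p.440] -/
theorem d2KernelZ_eq_d2K (η : ℝ) (μ' μ : Fin (2 + 1)) (G : KernelZ 2) (x x' : Fin (2 + 1) → ℤ) :
    d2KernelZ η⁻¹ μ' μ G x x' = d2K η μ' μ G x x' := rfl

/-- dictionary: `η³·(combined kernel) = tr q²·nonloc` (gen 9's non-local integrand of `Π_{μμ′}`, `B3Pi2ZeroLattice.nonloc`).
[cite: Balaban1983Higgs3, (3.26) p.440] -/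
theorem kerCZ_eq_nonloc (η τ : ℝ) (Gj Gj' : KernelZ 2) (μ μ' : Fin (2 + 1)) (x x' : Fin (2 + 1) → ℤ) :
    η ^ (2 + 1) * kerCZ η τ Gj Gj' μ μ' x x' = τ * nonloc η Gj Gj' μ μ' x x' := by
  simp only [kerCZ, kerAZ, kerBZ, nonloc, dAdjKernelZ_eq_dK2, d2KernelZ_eq_d2K]
  ring

/-- dictionary: `η³·(combined kernel)·(x′_ν − x_ν) = tr q²·nonloc3` (gen 9's weighted integrand of `Π_{μμ′ν}`,
`B3Pi3ZeroLattice.nonloc3`). [cite: Balaban1983Higgs3, (3.26) p.440; p.441] -/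
theorem kerCZ_disp_eq_nonloc3 (η τ : ℝ) (Gj Gj' : KernelZ 2) (μ μ' ν : Fin (2 + 1)) (x x' : Fin (2 + 1) → ℤ) :
    η ^ (2 + 1) * (kerCZ η τ Gj Gj' μ μ' x x' * (η * ((x' ν - x ν : ℤ) : ℝ))) = τ * nonloc3 η Gj Gj' μ μ' ν x x' := by
  simp only [kerCZ, kerAZ, kerBZ, nonloc3, dAdjKernelZ_eq_dK2, d2KernelZ_eq_d2K, Int.cast_sub]
  ring

/-- **The p. 440 form of the square bracket** — *"The expression in the square bracket on the right side of (3.26) has the form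
Σ_x η^d Σ_{μ,μ′=1}^d g(x)A_μ(x)Π^{(η,j₀)}_{μμ′}(x)g′(x)A′_{μ′}(x)"* — with gen 9's infinite-lattice kernel `Π_{μμ′}[G₁,G₂,G₃]`
(`B3Pi2ZeroLattice.Pi2L`, the `x′`-sum over all of `ℤ³`) and the localization set `Λ ∋ x`. [cite: Balaban1983Higgs3, (3.26) p.440] -/
def piForm2 (η τ : ℝ) (G₁ G₂ G₃ : KernelZ 2) (g g' : (Fin (2 + 1) → ℤ) → ℝ) (A A' : Fin (2 + 1) → (Fin (2 + 1) → ℤ) → ℝ)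
    (Λ : Finset (Fin (2 + 1) → ℤ)) : ℝ :=
  ∑ x ∈ Λ, η ^ (2 + 1) * ∑ μ : Fin (2 + 1), ∑ μ' : Fin (2 + 1),
    g x * A μ x * Pi2L η τ G₁ G₂ G₃ μ μ' x * (g' x * A' μ' x)

/-- **The p. 441 form of the first curly bracket** — *"the expression in the first curly bracket has the form
Σ_{ν=1}^d Σ_x η^d Σ_{μ,μ′=1}^d g(x)A_μ(x)Π^{(η,j₀)}_{μμ′ν}(x)(∂^η_ν g′A′_{μ′})(x)"* — with gen 9's `Π_{μμ′ν}[G₁,G₂]`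
(`B3Pi3ZeroLattice.Pi3L`) and the derivative leg `D ν μ′`. [cite: Balaban1983Higgs3, (3.26) p.440; p.441] -/
def piForm3 (η τ : ℝ) (G₁ G₂ : KernelZ 2) (g : (Fin (2 + 1) → ℤ) → ℝ) (A : Fin (2 + 1) → (Fin (2 + 1) → ℤ) → ℝ)
    (D : Fin (2 + 1) → Fin (2 + 1) → (Fin (2 + 1) → ℤ) → ℝ) (Λ : Finset (Fin (2 + 1) → ℤ)) : ℝ :=
  ∑ ν : Fin (2 + 1), ∑ x ∈ Λ, η ^ (2 + 1) * ∑ μ : Fin (2 + 1), ∑ μ' : Fin (2 + 1),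
    g x * A μ x * Pi3L η τ G₁ G₂ μ μ' ν x * D ν μ' x

/-- kernel: the square bracket with the `x′`-sum over a finite `Λ′`, in the p. 440 shape. [cite: Balaban1983Higgs3, (3.26) p.440] -/
theorem bracket326Z_eq (η τ : ℝ) (G₁ G₂ G₃ : KernelZ 2) (g g' : (Fin (2 + 1) → ℤ) → ℝ)
    (A A' : Fin (2 + 1) → (Fin (2 + 1) → ℤ) → ℝ) (Λ Λ' : Finset (Fin (2 + 1) → ℤ)) :
    bracket326Z η τ G₁ G₂ G₃ g g' A A' Λ Λ' =
      (∑ x ∈ Λ, η ^ (2 + 1) * ∑ μ : Fin (2 + 1), ∑ μ' : Fin (2 + 1),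
          g x * A μ x * (∑ x' ∈ Λ', τ * nonloc η G₁ G₂ μ μ' x x') * (g' x * A' μ' x)) -
        local326Z η τ G₃ g g' A A' Λ := by
  have h1 := pairSumZ_local η (kerCZ η τ G₁ G₂) g A (fun μ' x => g' x * A' μ' x) Λ Λ'
  rw [bracket326Z, graphs326Z_eq_pairSumZ_kerCZ,
    show pairSumZ η (kerCZ η τ G₁ G₂) g A (legNearZ g' A') Λ Λ' = _ from h1]
  simp only [kerCZ_eq_nonloc]

/-- kernel: the first curly bracket with the `x′`-sum over a finite `Λ′`, in the p. 441 shape. [cite: Balaban1983Higgs3, (3.26) p.440; p.441] -/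
theorem curly1Z_eq (η τ : ℝ) (G₁ G₂ : KernelZ 2) (g : (Fin (2 + 1) → ℤ) → ℝ) (A : Fin (2 + 1) → (Fin (2 + 1) → ℤ) → ℝ)
    (D : Fin (2 + 1) → Fin (2 + 1) → (Fin (2 + 1) → ℤ) → ℝ) (Λ Λ' : Finset (Fin (2 + 1) → ℤ)) :
    curly1Z η τ G₁ G₂ g A D Λ Λ' = ∑ ν : Fin (2 + 1), ∑ x ∈ Λ, η ^ (2 + 1) * ∑ μ : Fin (2 + 1), ∑ μ' : Fin (2 + 1),
      g x * A μ x * (∑ x' ∈ Λ', τ * nonloc3 η G₁ G₂ μ μ' ν x x') * D ν μ' x := by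
  simp only [curly1Z, pairSumZ_local, kerCZ_disp_eq_nonloc3]

/-- kernel: the p. 440 form splits as (non-local part) − (local graphs). [cite: Balaban1983Higgs3, (3.26) p.440] -/
theorem piForm2_eq (η τ : ℝ) (G₁ G₂ G₃ : KernelZ 2) (g g' : (Fin (2 + 1) → ℤ) → ℝ)
    (A A' : Fin (2 + 1) → (Fin (2 + 1) → ℤ) → ℝ) (Λ : Finset (Fin (2 + 1) → ℤ)) :
    piForm2 η τ G₁ G₂ G₃ g g' A A' Λ =
      (∑ x ∈ Λ, η ^ (2 + 1) * ∑ μ : Fin (2 + 1), ∑ μ' : Fin (2 + 1),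
          g x * A μ x * (τ * ∑' x', nonloc η G₁ G₂ μ μ' x x') * (g' x * A' μ' x)) -
        local326Z η τ G₃ g g' A A' Λ := by
  have hP : ∀ (μ μ' : Fin (2 + 1)) (x : Fin (2 + 1) → ℤ), Pi2L η τ G₁ G₂ G₃ μ μ' x =
      τ * (∑' x', nonloc η G₁ G₂ μ μ' x x') -
        (if μ = μ' then τ * G₃ x x + τ * (η * dAdjKernelZ η⁻¹ μ G₃ x x) else 0) := by
    intro μ μ' x
    rw [dAdjKernelZ_eq_dK2, Pi2L]
    split_ifs <;> ring
  have hloc : ∀ x : Fin (2 + 1) → ℤ, ∑ μ : Fin (2 + 1), ∑ μ' : Fin (2 + 1),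
      g x * A μ x * (if μ = μ' then τ * G₃ x x + τ * (η * dAdjKernelZ η⁻¹ μ G₃ x x) else 0) * (g' x * A' μ' x) =
      ∑ μ : Fin (2 + 1), g x * A μ x * g' x * A' μ x * (τ * G₃ x x + τ * (η * dAdjKernelZ η⁻¹ μ G₃ x x)) := by
    intro x
    simp only [mul_ite, ite_mul, zero_mul, mul_zero, Finset.sum_ite_eq, Finset.mem_univ, if_true]
    exact Finset.sum_congr rfl fun μ _ => by ring
  rw [piForm2, local326Z, ← Finset.sum_sub_distrib]
  refine Finset.sum_congr rfl fun x _ => ?_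
  rw [← hloc x, ← mul_sub, ← Finset.sum_sub_distrib]
  congr 1
  refine Finset.sum_congr rfl fun μ _ => ?_
  rw [← Finset.sum_sub_distrib]
  refine Finset.sum_congr rfl fun μ' _ => ?_
  rw [hP]
  ring

/-- **THE SQUARE BRACKET OF (3.26) CONVERGES TO ITS p. 440 FORM AS `Λ′ ↑ ℤ³`** (`d = 3`): if the non-local integrands
`nonloc[G₁,G₂]_{μμ′}(x,·)` are summable for `x ∈ Λ`, then `[…](Λ,Λ′) → Σ_{x∈Λ} η³ Σ_{μμ′} gA_μ(x)Π_{μμ′}[G₁,G₂,G₃](x)g′A′_{μ′}(x)`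
along the finite sets `Λ′` (the print's `Σ_{x′}` is over the whole lattice). [cite: Balaban1983Higgs3, (3.26) p.440] -/
theorem tendsto_bracket326Z (η τ : ℝ) (G₁ G₂ G₃ : KernelZ 2) (g g' : (Fin (2 + 1) → ℤ) → ℝ)
    (A A' : Fin (2 + 1) → (Fin (2 + 1) → ℤ) → ℝ) (Λ : Finset (Fin (2 + 1) → ℤ))
    (hs : ∀ (μ μ' : Fin (2 + 1)), ∀ x ∈ Λ, Summable (nonloc η G₁ G₂ μ μ' x)) :
    Tendsto (fun Λ' : Finset (Fin (2 + 1) → ℤ) => bracket326Z η τ G₁ G₂ G₃ g g' A A' Λ Λ') atTop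
      (𝓝 (piForm2 η τ G₁ G₂ G₃ g g' A A' Λ)) := by
  simp only [bracket326Z_eq, piForm2_eq]
  refine Tendsto.sub_const ?_ _
  refine tendsto_finsetSum _ fun x hx => Tendsto.const_mul _ ?_
  refine tendsto_finsetSum _ fun μ _ => tendsto_finsetSum _ fun μ' _ => Tendsto.mul_const _ (Tendsto.const_mul _ ?_)
  rw [← tsum_mul_left]
  exact ((hs μ μ' x hx).mul_left τ).hasSum

/-- **THE FIRST CURLY BRACKET OF (3.26) CONVERGES TO ITS p. 441 FORM AS `Λ′ ↑ ℤ³`** (`d = 3`), given summability of the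
weighted integrands `nonloc3[G₁,G₂]_{μμ′ν}(x,·)` for `x ∈ Λ`. [cite: Balaban1983Higgs3, (3.26) p.440; p.441] -/
theorem tendsto_curly1Z (η τ : ℝ) (G₁ G₂ : KernelZ 2) (g : (Fin (2 + 1) → ℤ) → ℝ) (A : Fin (2 + 1) → (Fin (2 + 1) → ℤ) → ℝ)
    (D : Fin (2 + 1) → Fin (2 + 1) → (Fin (2 + 1) → ℤ) → ℝ) (Λ : Finset (Fin (2 + 1) → ℤ))
    (hs : ∀ (μ μ' ν : Fin (2 + 1)), ∀ x ∈ Λ, Summable (nonloc3 η G₁ G₂ μ μ' ν x)) :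
    Tendsto (fun Λ' : Finset (Fin (2 + 1) → ℤ) => curly1Z η τ G₁ G₂ g A D Λ Λ') atTop
      (𝓝 (piForm3 η τ G₁ G₂ g A D Λ)) := by
  simp only [curly1Z_eq, piForm3, Pi3L]
  refine tendsto_finsetSum _ fun ν _ => tendsto_finsetSum _ fun x hx => Tendsto.const_mul _ ?_
  refine tendsto_finsetSum _ fun μ _ => tendsto_finsetSum _ fun μ' _ => Tendsto.mul_const _ (Tendsto.const_mul _ ?_)
  rw [← tsum_mul_left]
  exact ((hs μ μ' ν x hx).mul_left τ).hasSum

end PiForms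

/-! ### the summability of the integrands for the infinite-lattice propagators `G^ξ_{j₀}(0)` and `G^η_{j₀}(0)` -/

section Summability

variable {ℓ k : ℕ} {a m2 : ℝ}

/-- kernel: the non-local integrand of `Π_{μμ′}` with `G^ξ_k(0)` in both slots is summable in `y′` (gen 9's decomposition
`G = C^ξ + M` and its three summable pieces). [cite: Balaban1983Higgs3, (3.26) p.440; (3.16) p.437] -/
theorem summable_nonloc_GxiL (hℓ : 1 ≤ ℓ) (hk : 1 ≤ k) (ha : 0 < a) (hm : 0 ≤ m2) (μ μ' : Fin 3) (y : ZSite 3) :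
    Summable (nonloc (xiOf ℓ k) (GxiL ℓ k a m2) (GxiL ℓ k a m2) μ μ' y) := by
  obtain ⟨δ, C, K, hδ, hδh, hC1, hK, hB⟩ := exists_bounds hℓ a a m2 ha
  have hδ1 : δ ≤ 1 := hδh.trans (by norm_num)
  have hC0 : 0 ≤ C := le_trans (by norm_num) hC1
  obtain ⟨⟨-, -, l3, -, -, -, l7, l8, -⟩, bM, bd2, bunif, fub, -, -⟩ := hB k hk a m2 le_rfl le_rfl hm le_rfl
  obtain ⟨sCM, -⟩ := tsum_nonloc_conv_M_bound hδ hδ1 hC0 hK.le l7 bd2 bunif μ μ' y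
  obtain ⟨sMG, -⟩ := tsum_nonloc_M_G_bound hδ hδ1 hC0 l3 bM fub μ μ' y
  have sCC := summable_nonloc_conv_conv hδ hδ1 hC0 l7 l8 μ μ' y
  have hG := GxiL_eq_conv_add ℓ k a m2
  refine ((sCC.add sCM).add sMG).congr fun y' => ?_
  symm
  show nonloc (xiOf ℓ k) (GxiL ℓ k a m2) (GxiL ℓ k a m2) μ μ' y y' = _
  conv_lhs => rw [hG]
  rw [nonloc_add_left, ← hG]
  conv_lhs => arg 1; rw [hG]
  rw [nonloc_add_right]

/-- kernel: the weighted integrand of `Π_{μμ′ν}` with `G^ξ_k(0)` in both slots is summable in `y′`.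
[cite: Balaban1983Higgs3, (3.26) p.440; p.441; (3.16) p.437] -/
theorem summable_nonloc3_GxiL (hℓ : 1 ≤ ℓ) (hk : 1 ≤ k) (ha : 0 < a) (hm : 0 ≤ m2) (μ μ' ν : Fin 3) (y : ZSite 3) :
    Summable (nonloc3 (xiOf ℓ k) (GxiL ℓ k a m2) (GxiL ℓ k a m2) μ μ' ν y) := by
  obtain ⟨δ, C, K, hδ, hδh, hC1, hK, hB⟩ := exists_bounds hℓ a a m2 ha
  have hδ1 : δ ≤ 1 := hδh.trans (by norm_num)
  have hC0 : 0 ≤ C := le_trans (by norm_num) hC1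
  obtain ⟨⟨-, -, l3, l4, -, -, l7, l8, -⟩, bM, bd2, -, -, fubw, fubt⟩ := hB k hk a m2 le_rfl le_rfl hm le_rfl
  obtain ⟨sCM, -⟩ := tsum_nonloc3_conv_M_bound hδ hδ1 hC0 hK.le l7 l8 bd2 fubt μ μ' ν y
  obtain ⟨sMG, -⟩ := tsum_nonloc3_M_G_bound hδ hδ1 hC0 hK.le l3 l4 bM fubw μ μ' ν y
  have sCC := summable_nonloc3_conv_conv hδ hδ1 hC0 l7 l8 μ μ' ν y
  have hG := GxiL_eq_conv_add ℓ k a m2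
  refine ((sCC.add sCM).add sMG).congr fun y' => ?_
  symm
  show nonloc3 (xiOf ℓ k) (GxiL ℓ k a m2) (GxiL ℓ k a m2) μ μ' ν y y' = _
  conv_lhs => rw [hG]
  rw [nonloc3_add_left, ← hG]
  conv_lhs => arg 1; rw [hG]
  rw [nonloc3_add_right]

/-- kernel: the same for the `η`-lattice reading `G^η_{j₀}(0) = GetaL ℓ j₀ k` (rescaling `nonloc_rescale`, factor `(L^{j₀}η)^{−1}`).
[cite: Balaban1983Higgs3, (3.26) p.440; p.441] -/
theorem summable_nonloc_GetaL (hℓ : 1 ≤ ℓ) {j₀ : ℕ} (hj : 1 ≤ j₀) (k : ℕ) (ha : 0 < a) (hm : 0 ≤ m2) (μ μ' : Fin 3)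
    (y : ZSite 3) : Summable (nonloc (xiOf ℓ k) (GetaL ℓ j₀ k a m2) (GetaL ℓ j₀ k a m2) μ μ' y) := by
  refine ((summable_nonloc_GxiL hℓ hj ha hm μ μ' y).mul_left (scale330 ℓ j₀ k)⁻¹).congr fun y' => ?_
  rw [GetaL_eq, xiOf_eq_scale_mul ℓ j₀ k]
  exact (nonloc_rescale (xiOf ℓ j₀) (GxiL ℓ j₀ a m2) (GxiL ℓ j₀ a m2) (scale330_pos ℓ j₀ k).ne' μ μ' y y').symm

/-- kernel: the same for the weighted integrand (rescaling `nonloc3_rescale`, factor `1`). [cite: Balaban1983Higgs3, (3.26) p.440; p.441] -/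
theorem summable_nonloc3_GetaL (hℓ : 1 ≤ ℓ) {j₀ : ℕ} (hj : 1 ≤ j₀) (k : ℕ) (ha : 0 < a) (hm : 0 ≤ m2) (μ μ' ν : Fin 3)
    (y : ZSite 3) : Summable (nonloc3 (xiOf ℓ k) (GetaL ℓ j₀ k a m2) (GetaL ℓ j₀ k a m2) μ μ' ν y) := by
  refine (summable_nonloc3_GxiL hℓ hj ha hm μ μ' ν y).congr fun y' => ?_
  rw [GetaL_eq, xiOf_eq_scale_mul ℓ j₀ k]
  exact (nonloc3_rescale (xiOf ℓ j₀) (GxiL ℓ j₀ a m2) (GxiL ℓ j₀ a m2) (scale330_pos ℓ j₀ k).ne' μ μ' ν y y').symm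

end Summability

/-! ### (3.26) → the Π-forms → the p. 441 display, for the resummed propagator `G^η_{j₀}(0)` on `ηℤ³` -/

section Instance

variable {ℓ : ℕ}

/-- **(3.26) AFTER THE RESUMMATION, ON THE PRINT'S CARRIER `ηℤ³`, WITH THE `x′`-SUMS OVER THE WHOLE LATTICE** (`d = 3`, zero field,
`η = L^{−k}`, `1 ≤ j₀`, `a > 0`, `m² ≥ 0`; `G^η_{j₀}(0) = GetaL ℓ j₀ k a m²` in all three slots — by p. 440's resummation sentence
(`lhs326Z_resum`) and the scale dictionary this is the propagator the print calls `G_{j₀}(0)`): for every `tr q²`, localizations and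
vector legs and every finite `Λ`,
(i) the square bracket converges, as `Λ′ ↑ ℤ³`, to `Σ_{x∈Λ} η³ Σ_{μμ′} gA_μ(x)Π^{(η,j₀)}_{μμ′}(x)g′A′_{μ′}(x)` (p. 440);
(ii) the first curly bracket converges to `Σ_ν Σ_{x∈Λ} η³ Σ_{μμ′} gA_μ(x)Π^{(η,j₀)}_{μμ′ν}(x)(∂^η_ν g′A′_{μ′})(x)` (p. 441).
[cite: Balaban1983Higgs3, (3.26) pp.440–441] -/
theorem tendsto_bracket326Z_curly1Z_GetaL (hℓ : 1 ≤ ℓ) {j₀ : ℕ} (hj : 1 ≤ j₀) (k : ℕ) {a m2 : ℝ} (ha : 0 < a)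
    (hm : 0 ≤ m2) (τ : ℝ) (g g' : (Fin (2 + 1) → ℤ) → ℝ) (A A' : Fin (2 + 1) → (Fin (2 + 1) → ℤ) → ℝ)
    (Λ : Finset (Fin (2 + 1) → ℤ)) :
    Tendsto (fun Λ' : Finset (Fin (2 + 1) → ℤ) =>
        bracket326Z (xiOf ℓ k) τ (GetaL ℓ j₀ k a m2) (GetaL ℓ j₀ k a m2) (GetaL ℓ j₀ k a m2) g g' A A' Λ Λ') atTop
      (𝓝 (piForm2 (xiOf ℓ k) τ (GetaL ℓ j₀ k a m2) (GetaL ℓ j₀ k a m2) (GetaL ℓ j₀ k a m2) g g' A A' Λ)) ∧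
    Tendsto (fun Λ' : Finset (Fin (2 + 1) → ℤ) =>
        curly1Z (xiOf ℓ k) τ (GetaL ℓ j₀ k a m2) (GetaL ℓ j₀ k a m2) g A
          (fun ν μ' x => pd (xiOf ℓ k)⁻¹ ν (fun z => g' z * A' μ' z) x) Λ Λ') atTop
      (𝓝 (piForm3 (xiOf ℓ k) τ (GetaL ℓ j₀ k a m2) (GetaL ℓ j₀ k a m2) g A
        (fun ν μ' x => pd (xiOf ℓ k)⁻¹ ν (fun z => g' z * A' μ' z) x) Λ)) :=
  ⟨tendsto_bracket326Z _ τ _ _ _ g g' A A' Λ fun μ μ' x _ => summable_nonloc_GetaL hℓ hj k ha hm μ μ' x,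
    tendsto_curly1Z _ τ _ _ g A _ Λ fun μ μ' ν x _ => summable_nonloc3_GetaL hℓ hj k ha hm μ μ' ν x⟩

/-- **p. 441: *"Now let us rescale the functions Π^{(η,j₀)}_{μμ′}, Π^{(η,j₀)}_{μμ′ν} from the η-lattice to the L^{−j₀}-lattice. We get
Π^{(η,j₀)}_{μμ′}(x) = (L^{j₀}η)^{−d+2}Π^{(L^{−j₀},j₀)}_{μμ′}(y), Π^{(η,j₀)}_{μμ′ν}(x) = (L^{j₀}η)^{−d+3}Π^{(L^{−j₀},j₀)}_{μμ′ν}(y), y = (L^{j₀}η)^{−1}x ∈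
T_{L^{−j₀}}. We consider the case d = 3, so −d + 2 = −1, −d + 3 = 0."*** — the two Π-forms of (3.26) for `G^η_{j₀}(0)` rewritten with
the `ξ = L^{−j₀}`-lattice kernels of `G^ξ_{j₀}(0) = GxiL ℓ j₀` (gen 11's `B3Eq330EtaZeroLattice.Pi2L_eta_eq` / `Pi3L_eta_eq`, the
lattice rescaling lemmas `Pi2L_rescale` / `Pi3L_rescale` of the `B3Pi2ZeroLattice` lineage): the `Π_{μμ′}`-form acquires the factor
`(L^{j₀}η)^{−1} = (scale330 ℓ j₀ k)⁻¹`, the `Π_{μμ′ν}`-form none. [cite: Balaban1983Higgs3, (3.26) p.440; p.441] -/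
theorem piForms_GetaL_rescale (ℓ j₀ k : ℕ) (a m2 τ : ℝ) (g g' : (Fin (2 + 1) → ℤ) → ℝ)
    (A A' : Fin (2 + 1) → (Fin (2 + 1) → ℤ) → ℝ) (D : Fin (2 + 1) → Fin (2 + 1) → (Fin (2 + 1) → ℤ) → ℝ)
    (Λ : Finset (Fin (2 + 1) → ℤ)) :
    piForm2 (xiOf ℓ k) τ (GetaL ℓ j₀ k a m2) (GetaL ℓ j₀ k a m2) (GetaL ℓ j₀ k a m2) g g' A A' Λ =
        (scale330 ℓ j₀ k)⁻¹ * ∑ x ∈ Λ, xiOf ℓ k ^ (2 + 1) * ∑ μ : Fin (2 + 1), ∑ μ' : Fin (2 + 1),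
          g x * A μ x * Pi2L (xiOf ℓ j₀) τ (GxiL ℓ j₀ a m2) (GxiL ℓ j₀ a m2) (GxiL ℓ j₀ a m2) μ μ' x * (g' x * A' μ' x) ∧
      piForm3 (xiOf ℓ k) τ (GetaL ℓ j₀ k a m2) (GetaL ℓ j₀ k a m2) g A D Λ =
        ∑ ν : Fin (2 + 1), ∑ x ∈ Λ, xiOf ℓ k ^ (2 + 1) * ∑ μ : Fin (2 + 1), ∑ μ' : Fin (2 + 1),
          g x * A μ x * Pi3L (xiOf ℓ j₀) τ (GxiL ℓ j₀ a m2) (GxiL ℓ j₀ a m2) μ μ' ν x * D ν μ' x := by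
  refine ⟨?_, ?_⟩
  · simp only [piForm2, Pi2L_eta_eq, Finset.mul_sum]
    refine Finset.sum_congr rfl fun x _ => Finset.sum_congr rfl fun μ _ => Finset.sum_congr rfl fun μ' _ => ?_
    ring
  · simp only [piForm3, Pi3L_eta_eq]

/-- **THE SENTENCE AFTER (3.30) FOR THESE COEFFICIENTS** (gen 11's `eq330_coefficients_zero_lattice`, restated next to the Π-forms it is
about): ONE constant `Cst` (from `L` and the window) such that for all `1 ≤ j₀ ≤ k` and window points the coefficient kernels of the two
Π-forms above obey `|Π^{(η,j₀)}_{μμ′ν}(x)| ≤ Cst·|tr q²|` (*"bounded"*) and `|Π^{(η,j₀)}_{μμ′}(x)| ≤ Cst·(L^{j₀}η)^{−1}·|tr q²|` (*"proportional to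
(L^{j₀}η)^{−d+2}"*). [cite: Balaban1983Higgs3, (3.30) p.442] -/
theorem piForms_GetaL_coefficients (hℓ : 1 ≤ ℓ) (amin aplus m2plus : ℝ) (ha : 0 < amin) :
    ∃ Cst : ℝ, 0 < Cst ∧ ∀ (j₀ k : ℕ), 1 ≤ j₀ → j₀ ≤ k → ∀ (a m2 : ℝ), amin ≤ a → a ≤ aplus → 0 ≤ m2 → m2 ≤ m2plus →
      ∀ (τ : ℝ) (μ μ' ν : Fin 3) (x : ZSite 3),
        |Pi3L (xiOf ℓ k) τ (GetaL ℓ j₀ k a m2) (GetaL ℓ j₀ k a m2) μ μ' ν x| ≤ Cst * |τ| ∧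
        |Pi2L (xiOf ℓ k) τ (GetaL ℓ j₀ k a m2) (GetaL ℓ j₀ k a m2) (GetaL ℓ j₀ k a m2) μ μ' x| ≤
          Cst * (scale330 ℓ j₀ k)⁻¹ * |τ| :=
  eq330_coefficients_zero_lattice hℓ amin aplus m2plus ha

/-- **(3.26) ON THE PRINT'S CARRIER, ASSEMBLED** (`d = 3`, zero field, `L = ℓ + 1 ≥ 2`, window `[a₋,a₊] × [0,m²₊]`, `a₋ > 0`): there is
`Cst > 0` (from `L` and the window) such that for all `1 ≤ j₀ ≤ k` (`η = L^{−k}`), window points `(a, m²)` (the resummed propagator's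
running mass `m²/s_{j₀}²` is again a window point), `tr q²`, localizations `g, g′`, vector legs `A, A′` and finite `Λ ∋ x`, with
`G = G^η_{j₀}(0) = GetaL ℓ j₀ k a m²` in all slots:
(a) (3.26) holds for every `Λ′` (`eq326Z`);
(b) as `Λ′ ↑ ℤ³` the square bracket tends to the `Π^{(η,j₀)}_{μμ′}`-form and the first curly bracket to the `Π^{(η,j₀)}_{μμ′ν}`-form (pp. 440–441);
(c) the p. 441 display: the `Π_{μμ′}`-form equals `(L^{j₀}η)^{−1}` times the same form with the `L^{−j₀}`-lattice kernel `Π^{(ξ,j₀)}[G^ξ_{j₀}(0)]`, the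
`Π_{μμ′ν}`-form equals the `ξ`-lattice one;
(d) *"the coefficient at the vertex [Π_{μμ′ν}] is bounded, and the coefficient at the vertex [Π_{μμ′}] is proportional to (L^{j₀}η)^{−d+2}"*:
`|Π^{(η,j₀)}_{μμ′ν}(x)| ≤ Cst·|tr q²|`, `|Π^{(η,j₀)}_{μμ′}(x)| ≤ Cst·(L^{j₀}η)^{−1}·|tr q²|`, uniformly in `j₀, k` and the window.
[cite: Balaban1983Higgs3, (3.26) pp.440–442] -/
theorem eq326_zeroLattice (hℓ : 1 ≤ ℓ) (amin aplus m2plus : ℝ) (ha : 0 < amin) :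
    ∃ Cst : ℝ, 0 < Cst ∧ ∀ (j₀ k : ℕ), 1 ≤ j₀ → j₀ ≤ k → ∀ (a m2 : ℝ), amin ≤ a → a ≤ aplus → 0 ≤ m2 → m2 ≤ m2plus →
      ∀ (τ : ℝ) (g g' : (Fin (2 + 1) → ℤ) → ℝ) (A A' : Fin (2 + 1) → (Fin (2 + 1) → ℤ) → ℝ) (Λ : Finset (Fin (2 + 1) → ℤ)),
        (∀ Λ' : Finset (Fin (2 + 1) → ℤ),
          lhs326Z (xiOf ℓ k) τ (GetaL ℓ j₀ k a m2) (GetaL ℓ j₀ k a m2) (GetaL ℓ j₀ k a m2) g g' A A' Λ Λ' =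
            bracket326Z (xiOf ℓ k) τ (GetaL ℓ j₀ k a m2) (GetaL ℓ j₀ k a m2) (GetaL ℓ j₀ k a m2) g g' A A' Λ Λ' +
              curly1Z (xiOf ℓ k) τ (GetaL ℓ j₀ k a m2) (GetaL ℓ j₀ k a m2) g A
                (fun ν μ' x => pd (xiOf ℓ k)⁻¹ ν (fun z => g' z * A' μ' z) x) Λ Λ' +
              curly2Z (xiOf ℓ k) τ (GetaL ℓ j₀ k a m2) (GetaL ℓ j₀ k a m2) g A
                (fun μ' x x' => rem (xiOf ℓ k)⁻¹ (fun z => g' z * A' μ' z) x x') Λ Λ') ∧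
        Tendsto (fun Λ' : Finset (Fin (2 + 1) → ℤ) =>
            bracket326Z (xiOf ℓ k) τ (GetaL ℓ j₀ k a m2) (GetaL ℓ j₀ k a m2) (GetaL ℓ j₀ k a m2) g g' A A' Λ Λ') atTop
          (𝓝 (piForm2 (xiOf ℓ k) τ (GetaL ℓ j₀ k a m2) (GetaL ℓ j₀ k a m2) (GetaL ℓ j₀ k a m2) g g' A A' Λ)) ∧
        Tendsto (fun Λ' : Finset (Fin (2 + 1) → ℤ) =>
            curly1Z (xiOf ℓ k) τ (GetaL ℓ j₀ k a m2) (GetaL ℓ j₀ k a m2) g A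
              (fun ν μ' x => pd (xiOf ℓ k)⁻¹ ν (fun z => g' z * A' μ' z) x) Λ Λ') atTop
          (𝓝 (piForm3 (xiOf ℓ k) τ (GetaL ℓ j₀ k a m2) (GetaL ℓ j₀ k a m2) g A
            (fun ν μ' x => pd (xiOf ℓ k)⁻¹ ν (fun z => g' z * A' μ' z) x) Λ)) ∧
        (piForm2 (xiOf ℓ k) τ (GetaL ℓ j₀ k a m2) (GetaL ℓ j₀ k a m2) (GetaL ℓ j₀ k a m2) g g' A A' Λ =
            (scale330 ℓ j₀ k)⁻¹ * ∑ x ∈ Λ, xiOf ℓ k ^ (2 + 1) * ∑ μ : Fin (2 + 1), ∑ μ' : Fin (2 + 1),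
              g x * A μ x * Pi2L (xiOf ℓ j₀) τ (GxiL ℓ j₀ a m2) (GxiL ℓ j₀ a m2) (GxiL ℓ j₀ a m2) μ μ' x * (g' x * A' μ' x) ∧
          piForm3 (xiOf ℓ k) τ (GetaL ℓ j₀ k a m2) (GetaL ℓ j₀ k a m2) g A
              (fun ν μ' x => pd (xiOf ℓ k)⁻¹ ν (fun z => g' z * A' μ' z) x) Λ =
            ∑ ν : Fin (2 + 1), ∑ x ∈ Λ, xiOf ℓ k ^ (2 + 1) * ∑ μ : Fin (2 + 1), ∑ μ' : Fin (2 + 1),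
              g x * A μ x * Pi3L (xiOf ℓ j₀) τ (GxiL ℓ j₀ a m2) (GxiL ℓ j₀ a m2) μ μ' ν x *
                pd (xiOf ℓ k)⁻¹ ν (fun z => g' z * A' μ' z) x) ∧
        (∀ (μ μ' ν : Fin 3) (x : ZSite 3),
          |Pi3L (xiOf ℓ k) τ (GetaL ℓ j₀ k a m2) (GetaL ℓ j₀ k a m2) μ μ' ν x| ≤ Cst * |τ| ∧
          |Pi2L (xiOf ℓ k) τ (GetaL ℓ j₀ k a m2) (GetaL ℓ j₀ k a m2) (GetaL ℓ j₀ k a m2) μ μ' x| ≤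
            Cst * (scale330 ℓ j₀ k)⁻¹ * |τ|) := by
  obtain ⟨Cst, hCst, hB⟩ := piForms_GetaL_coefficients hℓ amin aplus m2plus ha
  refine ⟨Cst, hCst, ?_⟩
  intro j₀ k hj hjk a m2 ha1 ha2 hm1 hm2 τ g g' A A' Λ
  have ha' : 0 < a := ha.trans_le ha1
  obtain ⟨h1, h2⟩ := tendsto_bracket326Z_curly1Z_GetaL hℓ hj k ha' hm1 τ g g' A A' Λ
  exact ⟨fun Λ' => eq326Z _ τ _ _ _ g g' A A' Λ Λ', h1, h2, piForms_GetaL_rescale ℓ j₀ k a m2 τ g g' A A' _ Λ,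
    fun μ μ' ν x => hB j₀ k hj hjk a m2 ha1 ha2 hm1 hm2 τ μ μ' ν x⟩

end Instance

/-! ## §4 (3.31) on `ηℤ^{d+1}`: the degree-0 graphs, split into a convergent term and a local term -/

section Eq331

variable {d : ℕ}

/-- kernel: `ℓ¹`-distance zero means equality. [folklore] -/
private theorem eq_of_dist₁_eq_zero {x x' : Fin (d + 1) → ℤ} (h : dist₁ x x' = 0) : x = x' := by
  funext μ
  have hμ : (x μ - x' μ).natAbs = 0 := by
    have := Finset.sum_eq_zero_iff.1 h μ (Finset.mem_univ μ)
    exact this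
  rw [Int.natAbs_eq_zero, sub_eq_zero] at hμ
  exact hμ

/-- **(3.31)** p. 442 [PDF 32], generic form ON `ηℤ^{d+1}` — PROVED for any two-point weight `w` vanishing only on the diagonal (in print
`w(x,x′) = |x′ − x|^α`): `Σ_{x∈Λ,x′∈Λ′}η^{2d}Σ_{μμ′}gA_μ(x)Π_{μμ′}(x,x′)g′(x′)A′_{μ′}(x′) = Σ_{x,x′}η^{2d}Σ_{μμ′}gA_μ(x)Π_{μμ′}(x,x′)w(x,x′)·
(g′(x′)A′_{μ′}(x′) − g′(x)A′_{μ′}(x))/w(x,x′) + Σ_{x∈Λ}η^dΣ_{μμ′}gA_μ(x)(Σ_{x′∈Λ′}η^dΠ_{μμ′}(x,x′))g′(x)A′_{μ′}(x)` (add and subtract;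
`Π_{μμ′}(x,x′)` an arbitrary two-point kernel of the degree-0 graphs; r15's torus `eq331_of_weight` is the finite-volume twin).
[cite: Balaban1983Higgs3, (3.31) p.442] -/
theorem eq331Z_of_weight (η : ℝ) (K : Fin (d + 1) → Fin (d + 1) → KernelZ d) (g g' : (Fin (d + 1) → ℤ) → ℝ)
    (A A' : Fin (d + 1) → (Fin (d + 1) → ℤ) → ℝ) (w : (Fin (d + 1) → ℤ) → (Fin (d + 1) → ℤ) → ℝ)
    (hw : ∀ x x', w x x' = 0 → x = x') (Λ Λ' : Finset (Fin (d + 1) → ℤ)) :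
    pairSumZ η K g A (legFarZ g' A') Λ Λ' =
      pairSumZ η K g A (fun μ' x x' => w x x' * ((g' x' * A' μ' x' - g' x * A' μ' x) / w x x')) Λ Λ' +
        ∑ x ∈ Λ, η ^ (d + 1) * ∑ μ : Fin (d + 1), ∑ μ' : Fin (d + 1),
          g x * A μ x * (∑ x' ∈ Λ', η ^ (d + 1) * K μ μ' x x') * (g' x * A' μ' x) := by
  have hleg : legFarZ g' A' = fun μ' x x' =>
      w x x' * ((g' x' * A' μ' x' - g' x * A' μ' x) / w x x') + g' x * A' μ' x := by
    funext μ' x x'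
    simp only [legFarZ]
    by_cases h0 : w x x' = 0
    · have hx := hw x x' h0
      subst hx
      rw [sub_self, zero_div, mul_zero, zero_add]
    · rw [mul_div_cancel₀ _ h0]
      ring
  rw [hleg, pairSumZ_add_leg, pairSumZ_local η K g A (fun μ' x => g' x * A' μ' x)]

/-- **(3.31)** p. 442 [PDF 32] ON `ηℤ^{d+1}`, verbatim — *"We write Σ_{x,x′}η^{2d}Σ_{μ,μ′} g(x)A_μ(x)Π_{μμ′}(x,x′)g′(x′)A′_{μ′}(x′)
= Σ_{x,x′}η^{2d}Σ_{μ,μ′} g(x)A_μ(x)Π_{μμ′}(x,x′)|x′−x|^α (g′(x′)A′_{μ′}(x′) − g′(x)A′_{μ′}(x))/|x′−x|^α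
+ Σ_xη^dΣ_{μ,μ′} g(x)A_μ(x)(Σ_{x′}η^dΠ_{μμ′}(x,x′))g′(x)A′_{μ′}(x), (3.31)"* — PROVED, with `|x′ − x| = η·dist₁(x,x′)` (p26's `ℓ¹`
lattice distance), `η > 0`, any real exponent `α`, finite localization sets. [cite: Balaban1983Higgs3, (3.31) p.442] -/
theorem eq331Z (η α : ℝ) (hη : 0 < η) (K : Fin (d + 1) → Fin (d + 1) → KernelZ d) (g g' : (Fin (d + 1) → ℤ) → ℝ)
    (A A' : Fin (d + 1) → (Fin (d + 1) → ℤ) → ℝ) (Λ Λ' : Finset (Fin (d + 1) → ℤ)) :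
    pairSumZ η K g A (legFarZ g' A') Λ Λ' =
      pairSumZ η K g A (fun μ' x x' => (η * dist₁ x x') ^ α *
          ((g' x' * A' μ' x' - g' x * A' μ' x) / (η * dist₁ x x') ^ α)) Λ Λ' +
        ∑ x ∈ Λ, η ^ (d + 1) * ∑ μ : Fin (d + 1), ∑ μ' : Fin (d + 1),
          g x * A μ x * (∑ x' ∈ Λ', η ^ (d + 1) * K μ μ' x x') * (g' x * A' μ' x) :=
  eq331Z_of_weight η K g g' A A' (fun x x' => (η * dist₁ x x') ^ α) (fun x x' h0 => by
    have hnn : 0 ≤ η * (dist₁ x x' : ℝ) := by positivity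
    rw [Real.rpow_eq_zero_iff_of_nonneg hnn] at h0
    have h1 : (dist₁ x x' : ℝ) = 0 := by
      rcases mul_eq_zero.1 h0.1 with h2 | h2
      · exact absurd h2 hη.ne'
      · exact h2
    exact eq_of_dist₁_eq_zero (by exact_mod_cast h1)) Λ Λ'

/-- **THE LOCAL TERM OF (3.31) WITH THE `x′`-SUM OVER THE WHOLE LATTICE**: if the rows `Π_{μμ′}(x,·)`, `x ∈ Λ`, are summable, the second
term converges, as `Λ′ ↑ ℤ^{d+1}`, to `Σ_{x∈Λ}η^dΣ_{μμ′}gA_μ(x)(Σ'_{x′}η^dΠ_{μμ′}(x,x′))g′(x)A′_{μ′}(x)` — the vertex to which p. 442 applies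
*"the same transformations as previously"*. [cite: Balaban1983Higgs3, (3.31) p.442] -/
theorem tendsto_local331Z (η : ℝ) (K : Fin (d + 1) → Fin (d + 1) → KernelZ d) (g g' : (Fin (d + 1) → ℤ) → ℝ)
    (A A' : Fin (d + 1) → (Fin (d + 1) → ℤ) → ℝ) (Λ : Finset (Fin (d + 1) → ℤ))
    (hs : ∀ (μ μ' : Fin (d + 1)), ∀ x ∈ Λ, Summable (K μ μ' x)) :
    Tendsto (fun Λ' : Finset (Fin (d + 1) → ℤ) => ∑ x ∈ Λ, η ^ (d + 1) * ∑ μ : Fin (d + 1), ∑ μ' : Fin (d + 1),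
        g x * A μ x * (∑ x' ∈ Λ', η ^ (d + 1) * K μ μ' x x') * (g' x * A' μ' x)) atTop
      (𝓝 (∑ x ∈ Λ, η ^ (d + 1) * ∑ μ : Fin (d + 1), ∑ μ' : Fin (d + 1),
        g x * A μ x * (∑' x', η ^ (d + 1) * K μ μ' x x') * (g' x * A' μ' x))) := by
  refine tendsto_finsetSum _ fun x hx => Tendsto.const_mul _ ?_
  refine tendsto_finsetSum _ fun μ _ => tendsto_finsetSum _ fun μ' _ => Tendsto.mul_const _ (Tendsto.const_mul _ ?_)
  exact ((hs μ μ' x hx).mul_left _).hasSum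

end Eq331

end

end Literature.MathematicalPhysics.QuantumFieldTheory.Balaban1983to89.B3Eq326ZeroLattice
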